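import Mathlib
import Summits.Ventures.HodgeRepro.Statements
import Summits.Ventures.HodgeRepro.MuTableSeesaw
import Summits.Ventures.HodgeRepro.MuTableSwap

/-!
# Explicit seesaw data and the slot patterns they realise (sealed statement (b), blind cell `pub-hodge-repro`, seat p2)

Non-vacuity and non-degeneracy of the sealed bookkeeping, for EVERY CM field `L` and every `δ ∈ L`:

* `SeesawDatum.diag a b` — the datum `(a, b, a, b)` (isometry `W₀ ⊕ W₁ ≅ W₂ ⊕ W₃` by `g = 1`) and
  `SeesawDatum.cross a b` — the datum `(a, b, b, a)` (isometry by the coordinate swap `!![0, 1; 1, 0]`), for real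
  non-zero `a, b ∈ L`; in particular `SeesawDatum L` is inhabited (`SeesawDatum.defD = diag 1 1`).
* `slotDelta_defD`: the definite datum `(1, 1, 1, 1)` has `δ_S = 0` at every place.
* `slotDelta_splitD` / `slotDelta_splitD_ne_zero`: the split datum `(1, −1, 1, −1)` has
  `δ_S(w) = −(if 0 < im w(δ) then 3 else −3)` (never `0`) at every place; its relabelling bit is OFF
  (`not_conjSwapAt_splitD`), so `δ₂ = 0` and `δ₃ = δ_S` (`slotDelta₂_splitD`, `slotDelta₃_splitD`).
* `slotDelta_splitD'`: the split datum `(1, −1, −1, 1)` has the same `δ_S`; its relabelling bit is ON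
  (`conjSwapAt_splitD'`), so `δ₂ = δ_S` and `δ₃ = 0` (`slotDelta₂_splitD'`, `slotDelta₃_splitD'`).
* `exists_slotDelta₂_eq_zero_and_exists_slotDelta₃_eq_zero`: both cross-plane tables of the sealed partition
  `δ_S = δ₂ + δ₃`, `δ₂ δ₃ = 0` are realised (by data differing only in the isometry), at every place and for every `δ`.

Nothing here asserts anything about the Hodge conjecture; these are finite identities about the sealed definitions.
-/

set_option autoImplicit false

noncomputable section

namespace Summit.Ventures.HodgeRepro

namespace MuTable

open NumberField

variable {L : Type} [Field L] [NumberField L] [NumberField.IsCMField L]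

namespace SeesawDatum

/-! ### Two constructions of seesaw data from two real discriminants -/

/-- The diagonal datum `(a, b, a, b)`: `W₀ ⊕ W₁ ≅ W₂ ⊕ W₃` by `g = 1`. -/
def diag (a b : L) (ha : IsCMField.complexConj L a = a) (hb : IsCMField.complexConj L b = b)
    (ha0 : a ≠ 0) (hb0 : b ≠ 0) : SeesawDatum L where
  a := ![a, b, a, b]
  a_real := by
    intro i
    fin_cases i <;> simp [ha, hb]
  a_ne := by
    intro i
    fin_cases i <;> simp [ha0, hb0]
  iso := ⟨1, by
    rw [Units.val_one, Matrix.transpose_one, Matrix.map_one _ (map_zero _) (map_one _), Matrix.one_mul,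
      Matrix.mul_one]
    simp⟩

/-- The discriminants of the diagonal datum. -/
@[simp] theorem diag_a (a b : L) (ha : IsCMField.complexConj L a = a) (hb : IsCMField.complexConj L b = b)
    (ha0 : a ≠ 0) (hb0 : b ≠ 0) : (diag a b ha hb ha0 hb0).a = ![a, b, a, b] := rfl

/-- The coordinate swap `!![0, 1; 1, 0]` as an element of `GL₂(L)` (its own inverse). -/
def swapMat : GL (Fin 2) L :=
  ⟨!![0, 1; 1, 0], !![0, 1; 1, 0], by rw [Matrix.mul_fin_two, Matrix.one_fin_two]; simp,
    by rw [Matrix.mul_fin_two, Matrix.one_fin_two]; simp⟩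

omit [NumberField L] [IsCMField L] in
/-- The matrix of the coordinate swap. -/
@[simp] theorem swapMat_val : ((swapMat : GL (Fin 2) L) : Matrix (Fin 2) (Fin 2) L) = !![0, 1; 1, 0] := rfl

/-- The crossed datum `(a, b, b, a)`: `W₀ ⊕ W₁ ≅ W₂ ⊕ W₃` by the coordinate swap. -/
def cross (a b : L) (ha : IsCMField.complexConj L a = a) (hb : IsCMField.complexConj L b = b)
    (ha0 : a ≠ 0) (hb0 : b ≠ 0) : SeesawDatum L where
  a := ![a, b, b, a]
  a_real := by
    intro i
    fin_cases i <;> simp [ha, hb]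
  a_ne := by
    intro i
    fin_cases i <;> simp [ha0, hb0]
  iso := ⟨swapMat, by
    rw [swapMat_val]
    ext i j
    fin_cases i <;> fin_cases j <;> simp [Matrix.mul_apply, Fin.sum_univ_two, Matrix.diagonal]⟩

/-- The discriminants of the crossed datum. -/
@[simp] theorem cross_a (a b : L) (ha : IsCMField.complexConj L a = a) (hb : IsCMField.complexConj L b = b)
    (ha0 : a ≠ 0) (hb0 : b ≠ 0) : (cross a b ha hb ha0 hb0).a = ![a, b, b, a] := rfl

/-! ### The three test data `(1, 1, 1, 1)`, `(1, −1, 1, −1)`, `(1, −1, −1, 1)` -/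

/-- `−1` is real. -/
theorem complexConj_neg_one : IsCMField.complexConj L (-1) = -1 := by
  rw [map_neg, map_one]

/-- The definite datum `(1, 1, 1, 1)`. -/
def defD : SeesawDatum L := diag 1 1 (map_one _) (map_one _) one_ne_zero one_ne_zero

/-- The split datum `(1, −1, 1, −1)` (isometry `g = 1`; relabelling bit off). -/
def splitD : SeesawDatum L :=
  diag 1 (-1) (map_one _) complexConj_neg_one one_ne_zero (neg_ne_zero.2 one_ne_zero)

/-- The split datum `(1, −1, −1, 1)` (isometry = the coordinate swap; relabelling bit on). -/
def splitD' : SeesawDatum L :=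
  cross 1 (-1) (map_one _) complexConj_neg_one one_ne_zero (neg_ne_zero.2 one_ne_zero)

/-- Seesaw data exist over every CM field. -/
instance : Nonempty (SeesawDatum L) := ⟨defD⟩

/-- The discriminants of `defD`. -/
@[simp] theorem defD_a : (defD : SeesawDatum L).a = ![1, 1, 1, 1] := rfl

/-- The discriminants of `splitD`. -/
@[simp] theorem splitD_a : (splitD : SeesawDatum L).a = ![1, -1, 1, -1] := rfl

/-- The discriminants of `splitD'`. -/
@[simp] theorem splitD'_a : (splitD' : SeesawDatum L).a = ![1, -1, -1, 1] := rfl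

/-- Slot `0` of `defD` at `w`: `re w(1) = 1`. -/
theorem r_defD_zero (w : InfinitePlace L) : (defD : SeesawDatum L).r w 0 = 1 := by
  simp [r_def]

/-- Slot `1` of `defD` at `w`: `re w(1) = 1`. -/
theorem r_defD_one (w : InfinitePlace L) : (defD : SeesawDatum L).r w 1 = 1 := by
  simp [r_def]

/-- Slot `0` of `splitD` at `w`: `1`. -/
theorem r_splitD_zero (w : InfinitePlace L) : (splitD : SeesawDatum L).r w 0 = 1 := by
  simp [r_def]

/-- Slot `1` of `splitD` at `w`: `−1`. -/
theorem r_splitD_one (w : InfinitePlace L) : (splitD : SeesawDatum L).r w 1 = -1 := by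
  simp [r_def]

/-- Slot `2` of `splitD` at `w`: `1`. -/
theorem r_splitD_two (w : InfinitePlace L) : (splitD : SeesawDatum L).r w 2 = 1 := by
  simp [r_def]

/-- Slot `0` of `splitD'` at `w`: `1`. -/
theorem r_splitD'_zero (w : InfinitePlace L) : (splitD' : SeesawDatum L).r w 0 = 1 := by
  simp [r_def]

/-- Slot `1` of `splitD'` at `w`: `−1`. -/
theorem r_splitD'_one (w : InfinitePlace L) : (splitD' : SeesawDatum L).r w 1 = -1 := by
  simp [r_def]

/-- Slot `2` of `splitD'` at `w`: `−1`. -/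
theorem r_splitD'_two (w : InfinitePlace L) : (splitD' : SeesawDatum L).r w 2 = -1 := by
  simp [r_def]

/-- `¬ (0 < −1)` in `ℝ`. -/
theorem not_zero_lt_neg_one : ¬ (0 : ℝ) < -1 := by norm_num

end SeesawDatum

open SeesawDatum

/-! ### The slot tables of the three test data -/

/-- The definite datum: `δ_S = 0` at every place. -/
theorem slotDelta_defD (δ : L) (w : InfinitePlace L) : slotDelta δ (defD : SeesawDatum L) w = 0 := by
  simp [slotDelta_eq_zero_iff, r_defD_zero, r_defD_one]

/-- The split datum `(1, −1, 1, −1)`: `δ_S(w) = −(if 0 < im w(δ) then 3 else −3)` at every place. -/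
theorem slotDelta_splitD (δ : L) (w : InfinitePlace L) :
    slotDelta δ (splitD : SeesawDatum L) w = -(if 0 < (w.embedding δ).im then 3 else -3) := by
  rw [slotDelta_eq, r_splitD_zero, r_splitD_one,
    if_neg (fun h => not_zero_lt_neg_one (h.1 zero_lt_one)), if_neg not_zero_lt_neg_one, neg_one_mul]

/-- The split datum `(1, −1, 1, −1)`: `δ_S` never vanishes. -/
theorem slotDelta_splitD_ne_zero (δ : L) (w : InfinitePlace L) :
    slotDelta δ (splitD : SeesawDatum L) w ≠ 0 := by
  rw [slotDelta_splitD]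
  split_ifs <;> norm_num

/-- The split datum `(1, −1, −1, 1)`: the same slot table as `(1, −1, 1, −1)`. -/
theorem slotDelta_splitD' (δ : L) (w : InfinitePlace L) :
    slotDelta δ (splitD' : SeesawDatum L) w = -(if 0 < (w.embedding δ).im then 3 else -3) := by
  rw [slotDelta_eq, r_splitD'_zero, r_splitD'_one,
    if_neg (fun h => not_zero_lt_neg_one (h.1 zero_lt_one)), if_neg not_zero_lt_neg_one, neg_one_mul]

/-- The split datum `(1, −1, −1, 1)`: `δ_S` never vanishes. -/
theorem slotDelta_splitD'_ne_zero (δ : L) (w : InfinitePlace L) :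
    slotDelta δ (splitD' : SeesawDatum L) w ≠ 0 := by
  rw [slotDelta_splitD']
  split_ifs <;> norm_num

/-- The relabelling bit of `(1, −1, 1, −1)` is off at every place (`a₀ = a₂ = 1`). -/
theorem not_conjSwapAt_splitD (w : InfinitePlace L) : ¬ conjSwapAt (splitD : SeesawDatum L) w := by
  rw [conjSwapAt_iff, r_splitD_zero, r_splitD_two]
  exact fun h => h Iff.rfl

/-- The relabelling bit of `(1, −1, −1, 1)` is on at every place (`a₀ = 1`, `a₂ = −1`). -/
theorem conjSwapAt_splitD' (w : InfinitePlace L) : conjSwapAt (splitD' : SeesawDatum L) w := by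
  rw [conjSwapAt_iff, r_splitD'_zero, r_splitD'_two]
  exact fun h => not_zero_lt_neg_one (h.1 zero_lt_one)

/-- `(1, −1, 1, −1)`: `δ₂ = 0`. -/
theorem slotDelta₂_splitD (δ : L) (w : InfinitePlace L) : slotDelta₂ δ (splitD : SeesawDatum L) w = 0 := by
  unfold slotDelta₂
  rw [if_neg (not_conjSwapAt_splitD w)]

/-- `(1, −1, 1, −1)`: `δ₃ = δ_S`. -/
theorem slotDelta₃_splitD (δ : L) (w : InfinitePlace L) :
    slotDelta₃ δ (splitD : SeesawDatum L) w = slotDelta δ splitD w := by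
  unfold slotDelta₃
  rw [if_neg (not_conjSwapAt_splitD w)]

/-- `(1, −1, −1, 1)`: `δ₂ = δ_S`. -/
theorem slotDelta₂_splitD' (δ : L) (w : InfinitePlace L) :
    slotDelta₂ δ (splitD' : SeesawDatum L) w = slotDelta δ splitD' w := by
  unfold slotDelta₂
  rw [if_pos (conjSwapAt_splitD' w)]

/-- `(1, −1, −1, 1)`: `δ₃ = 0`. -/
theorem slotDelta₃_splitD' (δ : L) (w : InfinitePlace L) : slotDelta₃ δ (splitD' : SeesawDatum L) w = 0 := by
  unfold slotDelta₃
  rw [if_pos (conjSwapAt_splitD' w)]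

/-- **Both cross-plane tables are realised**: at every place and for every `δ` there is a seesaw datum with
`δ₂ = 0 ≠ δ₃` and one with `δ₃ = 0 ≠ δ₂` — the sealed partition `δ_S = δ₂ + δ₃`, `δ₂ δ₃ = 0` is not degenerate. -/
theorem exists_slotDelta₂_eq_zero_and_exists_slotDelta₃_eq_zero (δ : L) (w : InfinitePlace L) :
    (∃ S : SeesawDatum L, slotDelta₂ δ S w = 0 ∧ slotDelta₃ δ S w ≠ 0) ∧
    (∃ S : SeesawDatum L, slotDelta₃ δ S w = 0 ∧ slotDelta₂ δ S w ≠ 0) :=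
  ⟨⟨splitD, slotDelta₂_splitD δ w, by rw [slotDelta₃_splitD]; exact slotDelta_splitD_ne_zero δ w⟩,
    ⟨splitD', slotDelta₃_splitD' δ w, by rw [slotDelta₂_splitD']; exact slotDelta_splitD'_ne_zero δ w⟩⟩

/-- The slot table is not identically zero in the datum: `δ_S` vanishes for `defD` and not for `splitD`. -/
theorem exists_slotDelta_eq_zero_and_exists_slotDelta_ne_zero (δ : L) (w : InfinitePlace L) :
    (∃ S : SeesawDatum L, slotDelta δ S w = 0) ∧ (∃ S : SeesawDatum L, slotDelta δ S w ≠ 0) :=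
  ⟨⟨defD, slotDelta_defD δ w⟩, ⟨splitD, slotDelta_splitD_ne_zero δ w⟩⟩

end MuTable

end Summit.Ventures.HodgeRepro

end
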